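import Mathlib
import Summits.NavierStokesRegularity.NavierStokesRegularity.Theorems.FilamentSkeletonRssKelvinGateSharpLine

/-!
# Route `FilamentSkeletonRss` · LIVE crux `TransverseReduction1AG` (stmt-NavierStokesRegularity-27853) — line `kelvin_gate_sharp`, the
# TENURE RE-CUT (γ): dressing over A1G skeletons only (`DressedBase1AG`, cone bound (d7) in the hypothesis), composition re-threaded

Definitions + theorems (`--supports stmt-NavierStokesRegularity-27853 --as helper`).  HONEST FRAMING: bookkeeping for a HYPOTHETICAL
filament-type rotating-self-similar blow-up route (refutation side, MODEL rung); nothing here moves Navier–Stokes regularity; the stub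
statements below are OPEN (`def … : Prop`, never asserted); `TransverseReduction1AG` is neither proved nor refuted.

The A1G retype (route rev 22) = A1α + ONE box constant `KA` + ONE skeleton clause (d7) `Rw²·Γ·Aa j τ ≤ KA·(Rw²·Γ + ‖X j τ‖²)` (Γ-flat all-τ
core-area bound).  The lane's sharp line (`…KelvinGateSharpLine`, p639443) was cut on the aside A1α: S1′ `DressedBase1A` dresses EVERY A1α
skeleton.  Tenure ruling (γ) of 2026-08-28T14:09:31Z: MODEL job j306611 KILL-1 «matched-kernel datum lost» says a dressing residual
`C_rΓ^{-k}` in `Y♯_{3/2}` needs matched cores wherever the Biot–Savart kernel is integrated, so S1′ over un-matched skeletons claims more than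
the cone needs — re-cut S1′ to the A1G class.  This file does exactly that and nothing else:

* §1 `Clauses1AG` (the A1G clause block VERBATIM, `KA` threaded), `transverseReduction1AG_iff := Iff.rfl`, `clauses1A_of_1AG` (drop (d7));
* §2 the re-cut stubs as `Prop`s: S1′ `DressedBase1AG` (∀ box incl. `KA` ∃ `C_b c_b` ∀ `k` ∃ `C_r Γ₁` ∀ A1G skeleton ∃ `α₁ U⁰ P⁰`, `BaseSpec1A`)
  and S2′ `EventualSharpGate1AG` (as `EventualSharpGate1A` but over A1G skeletons, constants may depend on `KA`); monotonicity
  `dressedBase1AG_of_1A`, `eventualSharpGate1AG_of_1A` (both: one more hypothesis ⇒ weaker stub);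
* §3 `TransverseReduction1AG_of_sharp1AG : DressedBase1AG → EventualSharpGate1AG → TransverseReduction1AG` (the §4 proof of p639443 with
  the clause threaded: thresholds `rpow_gate_threshold`, S3′+S4′ = `SharpGateSpec.closing_smooth` via `concl1A_of_base_gate`), and the
  corollary `TransverseReduction1AG_of_sharp1AG' : DressedBase1AG → EventualSharpGate1A → TransverseReduction1AG`.
-/

set_option linter.dupNamespace false

noncomputable section

namespace Summit.NavierStokesRegularity.NavierStokesRegularity.Theorems.KelvinGate

open scoped BigOperators Topology InnerProductSpace RealInnerProductSpace ContDiff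
open Filter Set Function MeasureTheory
open Literature.Analysis.FluidPDE
open Summit.NavierStokesRegularity.NavierStokesRegularity.Theses.FilamentSkeletonRss

/-! ## 1. The A1G clause block, cut at its arrows (text VERBATIM; `KA` threaded) -/

/-- The skeleton clauses of `TransverseReduction1AG` (= those of `SkeletonJ1G`), VERBATIM: `Clauses1A` plus the Γ-flat all-τ core-area
bound (d7) `Rw²·Γ·Aa j τ ≤ KA·(Rw²·Γ + ‖X j τ‖²)` as the 14th conjunct. -/
def Clauses1AG (N : ℕ) (Γ δ ρ K Λ a b cnd Rw Rb cg θ₀ KA : ℝ) (γ : Fin N → ℝ) (α : ℝ) (X : Fin N → ℝ → EuclideanSpace ℝ (Fin 3))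
    (w : Fin N → ℝ → ℝ) (c : Fin N → ℝ) (m n : Fin N → EuclideanSpace ℝ (Fin 3)) (Aa : Fin N → ℝ → ℝ)
    (v : EuclideanSpace ℝ (Fin 3) → EuclideanSpace ℝ (Fin 3)) (A : Fin N → (EuclideanSpace ℝ (Fin 3) →L[ℝ] EuclideanSpace ℝ (Fin 3)))
    (T : (Fin N → ℝ → EuclideanSpace ℝ (Fin 3)) → Fin N → ℝ → EuclideanSpace ℝ (Fin 3)) : Prop :=
  (α ≠ 0 ∧ (∀ j, γ j ≠ 0)∧(∀ j, ContDiff ℝ 2 (X j) ∧ Differentiable ℝ (w j)∧(∀ τ, ‖deriv (X j) τ‖ = 1)∧(∀ τ, ‖iteratedDeriv 2 (X j) τ‖*√Γ≤K) ∧ Tendsto (fun τ => ‖X j τ‖) (cocompact ℝ) atTop)∧(∀ j k, j ≠ k → ∀ τ σ, ρ*√Γ≤‖X j τ-X k σ‖)∧(∀ j τ σ, ρ*√Γ≤|τ-σ| → cg*ρ*√Γ≤‖X j τ-X j σ‖)∧(∀ j τ, cg*|τ-c j|≤Rw*√Γ+‖X j τ‖)∧(∀ j τ, w j τ = ⟪v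 (X j τ), deriv (X j) τ⟫_ℝ)∧(∀ j τ, ‖X j τ‖≤Rb*√(Γ*Real.log Γ) → v (X j τ) = w j τ•deriv (X j) τ)∧(∀ j, ‖X j (c j)‖≤Rw*√Γ)∧(∀ j, |⟪deriv (X j) (c j), EuclideanSpace.single 2 1⟫_ℝ|≤1-θ₀)∧(θ₀≤|α| ∧ |α|≤θ₀⁻¹ ∧ ∀ j, θ₀≤|γ j| ∧ |γ j|≤θ₀⁻¹)∧(∀ j, w j (c j) = 0 ∧ (∀ τ, w j τ = 0 → τ = c j) ∧ 3/2+δ≤deriv (w j) (c j) ∧ deriv (w j) (c j)≤Λ)∧(∀ j, Differentiable ℝ (Aa j) ∧ (∀ τ, 0 < Aa j τ) ∧ ∀ τ, w j τ*deriv (Aa j) τ = (3/2-deriv (w j) τ)*Aa j τ+4)∧(∀ j τ, Rw^2*Γ*Aa j τ≤KA*(Rw^2*Γ+‖X j τ‖^2))∧(∀ j, Orthonormal ℝ ![deriv (X j) (c j), m j, n j] ∧ ⟪A j (m j), m j⟫_ℝ+⟪A j (n j), n j⟫_ℝ < 0 ∧ ⟪A j (n j), m j⟫_ℝ * ⟪A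 j (m j), n j⟫_ℝ < ⟪A j (m j), m j⟫_ℝ * ⟪A j (n j), n j⟫_ℝ)∧(∀ Y:Fin N → ℝ → EuclideanSpace ℝ (Fin 3), (∀ j, ContDiff ℝ 2 (Y j))→(∀ j τ, ⟪Y j τ, deriv (X j) τ⟫_ℝ = 0) → (∀ j τ, Rb*√(Γ*Real.log Γ) < ‖X j τ‖ → Y j τ = 0) → ∑ j, ⟪Y j (c j), cross (EuclideanSpace.single 2 1) (X j (c j))⟫_ℝ = 0 → (∀ j τ, ‖Y j τ‖+‖deriv (Y j) τ‖+‖iteratedDeriv 2 (Y j) τ‖≤(1+|τ-c j|)^b) → ∀ L:ℝ, (∀ j τ, ‖deriv (fun s:ℝ => T (fun k σ => X k σ+s•Y k σ) j τ) 0‖≤L*(1+|τ-c j|)^a) → ∀ j τ, ‖Y j τ‖≤cnd*L*(1+|τ-c j|)^b))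

/-- Sanity (definitional unfolding only): the live crux IS `∀ box constants incl. KA, ∃ Γ₁, ∀ Γ ≥ Γ₁, ∀ skeleton data, DefU1A → DefV1A →
DefA1A → DefT1A → Clauses1AG → ∃ α₁ C₀ M U P, Concl1A`. -/
theorem transverseReduction1AG_iff :
    TransverseReduction1AG ↔ ∀ (N:ℕ) (δ ρ K Λ a b cnd η Rw Rb cg θ₀ KA:ℝ), 0 < N → 0 < δ → 0 < ρ → 0 ≤ a → 0 < η → 0 < Rw → 0 < Rb → 0 < cg →
      0 < θ₀ → ∃ Γ₁:ℝ, ∀ Γ:ℝ, Γ₁≤Γ → ∀ (γ:Fin N → ℝ) (α:ℝ) (X:Fin N → ℝ → EuclideanSpace ℝ (Fin 3)) (w:Fin N → ℝ → ℝ) (c:Fin N → ℝ)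
        (m n:Fin N → EuclideanSpace ℝ (Fin 3)) (Aa:Fin N → ℝ → ℝ) (u:(Fin N → ℝ → EuclideanSpace ℝ (Fin 3)) → EuclideanSpace ℝ (Fin 3) → EuclideanSpace ℝ (Fin 3))
        (v:EuclideanSpace ℝ (Fin 3) → EuclideanSpace ℝ (Fin 3)) (A:Fin N → (EuclideanSpace ℝ (Fin 3) →L[ℝ] EuclideanSpace ℝ (Fin 3)))
        (T:(Fin N → ℝ → EuclideanSpace ℝ (Fin 3)) → Fin N → ℝ → EuclideanSpace ℝ (Fin 3)),
        DefU1A N Γ γ Aa u → DefV1A N α X u v → DefA1A N X c v A → DefT1A N α u T →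
        Clauses1AG N Γ δ ρ K Λ a b cnd Rw Rb cg θ₀ KA γ α X w c m n Aa v A T →
        ∃ (α₁ C₀ M:ℝ) (U:EuclideanSpace ℝ (Fin 3) → EuclideanSpace ℝ (Fin 3)) (P:EuclideanSpace ℝ (Fin 3) → ℝ), Concl1A N Γ ρ η Rw X u α₁ C₀ M U P :=
  Iff.rfl

/-- Clause monotonicity at the arrow: an A1G clause block is an A1α clause block (drop the 14th conjunct (d7)). [folklore] -/
theorem clauses1A_of_1AG {N : ℕ} {Γ δ ρ K Λ a b cnd Rw Rb cg θ₀ KA : ℝ} {γ : Fin N → ℝ} {α : ℝ}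
    {X : Fin N → ℝ → EuclideanSpace ℝ (Fin 3)} {w : Fin N → ℝ → ℝ} {c : Fin N → ℝ} {m n : Fin N → EuclideanSpace ℝ (Fin 3)}
    {Aa : Fin N → ℝ → ℝ} {v : EuclideanSpace ℝ (Fin 3) → EuclideanSpace ℝ (Fin 3)}
    {A : Fin N → (EuclideanSpace ℝ (Fin 3) →L[ℝ] EuclideanSpace ℝ (Fin 3))}
    {T : (Fin N → ℝ → EuclideanSpace ℝ (Fin 3)) → Fin N → ℝ → EuclideanSpace ℝ (Fin 3)}
    (h : Clauses1AG N Γ δ ρ K Λ a b cnd Rw Rb cg θ₀ KA γ α X w c m n Aa v A T) :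
    Clauses1A N Γ δ ρ K Λ a b cnd Rw Rb cg θ₀ γ α X w c m n Aa v A T := by
  obtain ⟨h1, h2, h3, h4, h5, h6, h7, h8, h9, h10, h11, h12, h13, -, h15, h16⟩ := h
  exact ⟨h1, h2, h3, h4, h5, h6, h7, h8, h9, h10, h11, h12, h13, h15, h16⟩

/-- The cone bound (d7) is what the re-cut ADDS to the dressing hypothesis: read it off an A1G clause block. [folklore] -/
theorem Clauses1AG.cone_bound {N : ℕ} {Γ δ ρ K Λ a b cnd Rw Rb cg θ₀ KA : ℝ} {γ : Fin N → ℝ} {α : ℝ}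
    {X : Fin N → ℝ → EuclideanSpace ℝ (Fin 3)} {w : Fin N → ℝ → ℝ} {c : Fin N → ℝ} {m n : Fin N → EuclideanSpace ℝ (Fin 3)}
    {Aa : Fin N → ℝ → ℝ} {v : EuclideanSpace ℝ (Fin 3) → EuclideanSpace ℝ (Fin 3)}
    {A : Fin N → (EuclideanSpace ℝ (Fin 3) →L[ℝ] EuclideanSpace ℝ (Fin 3))}
    {T : (Fin N → ℝ → EuclideanSpace ℝ (Fin 3)) → Fin N → ℝ → EuclideanSpace ℝ (Fin 3)}
    (h : Clauses1AG N Γ δ ρ K Λ a b cnd Rw Rb cg θ₀ KA γ α X w c m n Aa v A T) :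
    ∀ j τ, Rw ^ 2 * Γ * Aa j τ ≤ KA * (Rw ^ 2 * Γ + ‖X j τ‖ ^ 2) :=
  h.2.2.2.2.2.2.2.2.2.2.2.2.2.1

/-! ## 2. The re-cut stubs (as `Prop`s; never asserted here) -/

/-- Statement of stub S1′ RE-CUT · `DressedBase1AG` (size L/XL; matched asymptotics AT THE FINAL RATE over A1G skeletons only): for all box
constants INCLUDING `KA` there are size constants `C_b, c_b` such that for EVERY order `k` there are `C_r, Γ₁` with: every skeleton satisfying
the A1G clauses (incl. the Γ-flat cone bound (d7)) at `Γ ≥ Γ₁` admits a rate `α₁` and a dressed base `(U⁰, P⁰)` with `BaseSpec1A k C_b c_b C_r`. -/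
def DressedBase1AG : Prop :=
  ∀ (N:ℕ) (δ ρ K Λ a b cnd η Rw Rb cg θ₀ KA:ℝ), 0 < N → 0 < δ → 0 < ρ → 0 ≤ a → 0 < η → 0 < Rw → 0 < Rb → 0 < cg → 0 < θ₀ →
    ∃ Cb cb : ℝ, ∀ k : ℕ, ∃ Cr Γ₁ : ℝ, ∀ Γ:ℝ, Γ₁≤Γ → ∀ (γ:Fin N → ℝ) (α:ℝ) (X:Fin N → ℝ → EuclideanSpace ℝ (Fin 3)) (w:Fin N → ℝ → ℝ) (c:Fin N → ℝ)
      (m n:Fin N → EuclideanSpace ℝ (Fin 3)) (Aa:Fin N → ℝ → ℝ) (u:(Fin N → ℝ → EuclideanSpace ℝ (Fin 3)) → EuclideanSpace ℝ (Fin 3) → EuclideanSpace ℝ (Fin 3))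
      (v:EuclideanSpace ℝ (Fin 3) → EuclideanSpace ℝ (Fin 3)) (A:Fin N → (EuclideanSpace ℝ (Fin 3) →L[ℝ] EuclideanSpace ℝ (Fin 3)))
      (T:(Fin N → ℝ → EuclideanSpace ℝ (Fin 3)) → Fin N → ℝ → EuclideanSpace ℝ (Fin 3)),
      DefU1A N Γ γ Aa u → DefV1A N α X u v → DefA1A N X c v A → DefT1A N α u T →
      Clauses1AG N Γ δ ρ K Λ a b cnd Rw Rb cg θ₀ KA γ α X w c m n Aa v A T →
      ∃ (α₁ : ℝ) (U0 : EuclideanSpace ℝ (Fin 3) → EuclideanSpace ℝ (Fin 3)) (P0 : EuclideanSpace ℝ (Fin 3) → ℝ),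
        BaseSpec1A k Cb cb Cr N Γ ρ η Rw X u α₁ U0 P0

/-- Statement of stub S2′ RE-CUT · `EventualSharpGate1AG` (size XL; KILL-FIRST — the crux of the line): as `EventualSharpGate1A`, but only
around dressed bases of A1G skeletons, and the gate constants `κ, A₀, k₀` (and `Γ₂`) may depend on `KA` too.  For all box constants incl. `KA`
and size constants `C_b, c_b` there are `κ, A₀, k₀` such that for every `k ≥ k₀` and every `C_r`, for `Γ ≥ Γ₂`, around EVERY dressed base of
`BaseSpec1A k C_b c_b C_r` of an A1G skeleton the linearised profile operator `𝓛_(α₁,U⁰) + ∇` has a SHARP KELVIN GATE with bound `A₀Γ^κ`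
(`SharpGateSpec (3/2) (A₀Γ^κ) α₁ U⁰ K 𝒬`; linear, div-free, no rate multiplier). -/
def EventualSharpGate1AG : Prop :=
  ∀ (N:ℕ) (δ ρ K Λ a b cnd η Rw Rb cg θ₀ KA:ℝ), 0 < N → 0 < δ → 0 < ρ → 0 ≤ a → 0 < η → 0 < Rw → 0 < Rb → 0 < cg → 0 < θ₀ →
    ∀ Cb cb : ℝ, ∃ κ A₀ : ℝ, ∃ k₀ : ℕ, ∀ k : ℕ, k₀ ≤ k → ∀ Cr : ℝ, ∃ Γ₂ : ℝ, ∀ Γ:ℝ, Γ₂≤Γ →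
      ∀ (γ:Fin N → ℝ) (α:ℝ) (X:Fin N → ℝ → EuclideanSpace ℝ (Fin 3)) (w:Fin N → ℝ → ℝ) (c:Fin N → ℝ)
      (m n:Fin N → EuclideanSpace ℝ (Fin 3)) (Aa:Fin N → ℝ → ℝ) (u:(Fin N → ℝ → EuclideanSpace ℝ (Fin 3)) → EuclideanSpace ℝ (Fin 3) → EuclideanSpace ℝ (Fin 3))
      (v:EuclideanSpace ℝ (Fin 3) → EuclideanSpace ℝ (Fin 3)) (A:Fin N → (EuclideanSpace ℝ (Fin 3) →L[ℝ] EuclideanSpace ℝ (Fin 3)))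
      (T:(Fin N → ℝ → EuclideanSpace ℝ (Fin 3)) → Fin N → ℝ → EuclideanSpace ℝ (Fin 3)),
      DefU1A N Γ γ Aa u → DefV1A N α X u v → DefA1A N X c v A → DefT1A N α u T →
      Clauses1AG N Γ δ ρ K Λ a b cnd Rw Rb cg θ₀ KA γ α X w c m n Aa v A T →
      ∀ (α₁ : ℝ) (U0 : EuclideanSpace ℝ (Fin 3) → EuclideanSpace ℝ (Fin 3)) (P0 : EuclideanSpace ℝ (Fin 3) → ℝ),
        BaseSpec1A k Cb cb Cr N Γ ρ η Rw X u α₁ U0 P0 →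
        ∃ (K : (EuclideanSpace ℝ (Fin 3) → EuclideanSpace ℝ (Fin 3)) → EuclideanSpace ℝ (Fin 3) → EuclideanSpace ℝ (Fin 3))
          (𝒬 : (EuclideanSpace ℝ (Fin 3) → EuclideanSpace ℝ (Fin 3)) → EuclideanSpace ℝ (Fin 3) → ℝ),
          SharpGateSpec (3/2:ℝ) (A₀ * Γ ^ κ) α₁ U0 K 𝒬

/-- Monotonicity of the dressing stub: dressing every A1α skeleton (S1′ of p639443) dresses every A1G skeleton (ignore `KA`, drop (d7)). [folklore] -/
theorem dressedBase1AG_of_1A (h : DressedBase1A) : DressedBase1AG := by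
  intro N δ ρ K Λ a b cnd η Rw Rb cg θ₀ KA hN hδ hρ ha hη hRw hRb hcg hθ₀
  obtain ⟨Cb, cb, hS⟩ := h N δ ρ K Λ a b cnd η Rw Rb cg θ₀ hN hδ hρ ha hη hRw hRb hcg hθ₀
  refine ⟨Cb, cb, fun k => ?_⟩
  obtain ⟨Cr, Γ₁, hS'⟩ := hS k
  exact ⟨Cr, Γ₁, fun Γ hΓ γ α X w c m n Aa u v A T hu hv hA hT hcl =>
    hS' Γ hΓ γ α X w c m n Aa u v A T hu hv hA hT (clauses1A_of_1AG hcl)⟩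

/-- Monotonicity of the gate stub: a sharp gate around every dressed base of every A1α skeleton (S2′ of p639443) is one around every dressed
base of every A1G skeleton (ignore `KA`, drop (d7)). [folklore] -/
theorem eventualSharpGate1AG_of_1A (h : EventualSharpGate1A) : EventualSharpGate1AG := by
  intro N δ ρ K Λ a b cnd η Rw Rb cg θ₀ KA hN hδ hρ ha hη hRw hRb hcg hθ₀ Cb cb
  obtain ⟨κ, A₀, k₀, hS⟩ := h N δ ρ K Λ a b cnd η Rw Rb cg θ₀ hN hδ hρ ha hη hRw hRb hcg hθ₀ Cb cb
  refine ⟨κ, A₀, k₀, fun k hk Cr => ?_⟩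
  obtain ⟨Γ₂, hS'⟩ := hS k hk Cr
  exact ⟨Γ₂, fun Γ hΓ γ α X w c m n Aa u v A T hu hv hA hT hcl =>
    hS' Γ hΓ γ α X w c m n Aa u v A T hu hv hA hT (clauses1A_of_1AG hcl)⟩

/-! ## 3. The composition over the A1G class: S1′ + S2′ ⇒ `TransverseReduction1AG` BY NAME -/

/-- **Composition, re-threaded (pure logic + thresholds, no sorry).**  Dressing of A1G skeletons (S1′ re-cut) + eventual sharp gate around
their dressed bases (S2′ re-cut) give the LIVE crux `TransverseReduction1AG` BY NAME: `C_b, c_b` from S1′ → `κ, A₀, k₀` from S2′ →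
`k := max k₀ (⌈2κ⌉₊ + 1)` → `C_r, Γ₁` (S1′), `Γ₂` (S2′) → `Γ* := max (max Γ₁ Γ₂) (max 1 (16A₀²|C_r| + 4|A₀||C_r| + 8|A₀||C_r|/η + 1))`, then
`concl1A_of_base_gate` (= `SharpGateSpec.closing_smooth` + conclusion bookkeeping).  The §4 proof of p639443 with `KA` threaded. -/
theorem TransverseReduction1AG_of_sharp1AG (h1 : DressedBase1AG) (h2 : EventualSharpGate1AG) : TransverseReduction1AG := by
  refine transverseReduction1AG_iff.mpr ?_
  intro N δ ρ K Λ a b cnd η Rw Rb cg θ₀ KA hN hδ hρ ha hη hRw hRb hcg hθ₀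
  obtain ⟨Cb, cb, hS1⟩ := h1 N δ ρ K Λ a b cnd η Rw Rb cg θ₀ KA hN hδ hρ ha hη hRw hRb hcg hθ₀
  obtain ⟨κ, A₀, k₀, hS2⟩ := h2 N δ ρ K Λ a b cnd η Rw Rb cg θ₀ KA hN hδ hρ ha hη hRw hRb hcg hθ₀ Cb cb
  set k : ℕ := max k₀ (⌈2 * κ⌉₊ + 1) with hk
  have hk₀ : k₀ ≤ k := le_max_left _ _
  have hk1 : 1 ≤ k := le_trans (Nat.le_add_left 1 _) (le_max_right _ _)
  have hk2 : 2 * κ + 1 ≤ (k : ℝ) := by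
    have h1 : (⌈2 * κ⌉₊ : ℝ) + 1 ≤ (k : ℝ) := by
      have : ((⌈2 * κ⌉₊ + 1 : ℕ) : ℝ) ≤ (k : ℝ) := by exact_mod_cast le_max_right k₀ (⌈2 * κ⌉₊ + 1)
      push_cast at this; exact this
    linarith [Nat.le_ceil (2 * κ)]
  obtain ⟨Cr, Γ₁, hS1'⟩ := hS1 k
  obtain ⟨Γ₂, hS2'⟩ := hS2 k hk₀ Cr
  set Γ₃ : ℝ := max 1 (16 * A₀ ^ 2 * |Cr| + 4 * |A₀| * |Cr| + 8 * |A₀| * |Cr| / η + 1) with hΓ₃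
  refine ⟨max (max Γ₁ Γ₂) Γ₃, ?_⟩
  intro Γ hΓ γ α X w c m n Aa u v A T hu hv hA hT hcl
  have hΓ₁ : Γ₁ ≤ Γ := le_trans (le_trans (le_max_left _ _) (le_max_left _ _)) hΓ
  have hΓ₂ : Γ₂ ≤ Γ := le_trans (le_trans (le_max_right _ _) (le_max_left _ _)) hΓ
  have hΓ₃' : Γ₃ ≤ Γ := le_trans (le_max_right _ _) hΓ
  have hΓ1 : 1 ≤ Γ := le_trans (le_max_left _ _) hΓ₃'
  have hΓbig : 16 * A₀ ^ 2 * |Cr| + 4 * |A₀| * |Cr| + 8 * |A₀| * |Cr| / η + 1 ≤ Γ := le_trans (le_max_right _ _) hΓ₃'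
  have hΓ0 : 0 < Γ := by linarith
  obtain ⟨α₁, U0, P0, hbase⟩ := hS1' Γ hΓ₁ γ α X w c m n Aa u v A T hu hv hA hT hcl
  obtain ⟨Kop, Qop, hgate⟩ := hS2' Γ hΓ₂ γ α X w c m n Aa u v A T hu hv hA hT hcl α₁ U0 P0 hbase
  -- thresholds (verbatim from `TransverseReduction1A_of_sharp`)
  obtain ⟨ht1, ht2⟩ := rpow_gate_threshold (κ := κ) hΓ1 hk2 hk1
  have hCr : Cr ≤ |Cr| := le_abs_self Cr
  have hΓκ : 0 ≤ Γ ^ κ := Real.rpow_nonneg hΓ0.le κ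
  have hΓk : 0 ≤ Γ ^ (-(k:ℝ)) := Real.rpow_nonneg hΓ0.le _
  have hnn1 : 0 ≤ 16 * A₀ ^ 2 * |Cr| := by positivity
  have hnn2 : 0 ≤ 4 * |A₀| * |Cr| := by positivity
  have hnn3 : 0 ≤ 8 * |A₀| * |Cr| / η := by positivity
  have hACr : A₀ * Cr ≤ |A₀| * |Cr| := by rw [← abs_mul]; exact le_abs_self _
  have h16 : 16 * (A₀ * Γ ^ κ) ^ 2 * (Cr * Γ ^ (-(k:ℝ))) ≤ 1 := by
    have e : 16 * (A₀ * Γ ^ κ) ^ 2 * (Cr * Γ ^ (-(k:ℝ))) = 16 * A₀ ^ 2 * Cr * ((Γ ^ κ) ^ 2 * Γ ^ (-(k:ℝ))) := by ring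
    rw [e]
    have h1 : 16 * A₀ ^ 2 * Cr * ((Γ ^ κ) ^ 2 * Γ ^ (-(k:ℝ))) ≤ 16 * A₀ ^ 2 * Cr * Γ⁻¹ := by
      have hCr0 : 0 ≤ Cr := by
        have : 0 < Γ ^ (-(k:ℝ)) := Real.rpow_pos_of_pos hΓ0 _
        have hε0 : 0 ≤ Cr * Γ ^ (-(k:ℝ)) := hbase.2.2.2.2.2.2.1.nonneg
        nlinarith
      exact mul_le_mul_of_nonneg_left ht1 (by positivity)
    have h3 : 16 * A₀ ^ 2 * Cr ≤ Γ := by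
      have : 16 * A₀ ^ 2 * Cr ≤ 16 * A₀ ^ 2 * |Cr| := mul_le_mul_of_nonneg_left hCr (by positivity)
      linarith
    have h2 : 16 * A₀ ^ 2 * Cr * Γ⁻¹ ≤ 1 := by
      rw [show 16 * A₀ ^ 2 * Cr * Γ⁻¹ = (16 * A₀ ^ 2 * Cr) / Γ by rw [div_eq_mul_inv], div_le_one hΓ0]
      exact h3
    exact h1.trans h2
  have h2Aε : 2 * (A₀ * Γ ^ κ) * (Cr * Γ ^ (-(k:ℝ))) ≤ 2 * |A₀| * |Cr| * Γ⁻¹ := by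
    have e : 2 * (A₀ * Γ ^ κ) * (Cr * Γ ^ (-(k:ℝ))) = 2 * (A₀ * Cr) * (Γ ^ κ * Γ ^ (-(k:ℝ))) := by ring
    rw [e]
    have h1 : 2 * (A₀ * Cr) * (Γ ^ κ * Γ ^ (-(k:ℝ))) ≤ 2 * (|A₀| * |Cr|) * (Γ ^ κ * Γ ^ (-(k:ℝ))) :=
      mul_le_mul_of_nonneg_right (mul_le_mul_of_nonneg_left hACr (by norm_num)) (mul_nonneg hΓκ hΓk)
    calc _ ≤ 2 * (|A₀| * |Cr|) * (Γ ^ κ * Γ ^ (-(k:ℝ))) := h1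
      _ ≤ 2 * (|A₀| * |Cr|) * Γ⁻¹ := mul_le_mul_of_nonneg_left ht2 (by positivity)
      _ = 2 * |A₀| * |Cr| * Γ⁻¹ := by ring
  have hdivΓ : 2 * |A₀| * |Cr| * Γ⁻¹ = (2 * |A₀| * |Cr|) / Γ := by rw [div_eq_mul_inv]
  have hhalf : 2 * (A₀ * Γ ^ κ) * (Cr * Γ ^ (-(k:ℝ))) ≤ 1 / 2 := by
    refine h2Aε.trans ?_
    rw [hdivΓ, div_le_iff₀ hΓ0]
    linarith
  have hηΓ : 2 * (A₀ * Γ ^ κ) * (Cr * Γ ^ (-(k:ℝ))) ≤ η * √Γ / 2 := by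
    refine h2Aε.trans ?_
    have hsqrt : 1 ≤ √Γ := by rw [show (1:ℝ) = √1 by simp]; exact Real.sqrt_le_sqrt hΓ1
    have h1 : 2 * |A₀| * |Cr| * Γ⁻¹ ≤ η / 2 := by
      rw [hdivΓ, div_le_iff₀ hΓ0]
      have e : 8 * |A₀| * |Cr| / η * η = 8 * |A₀| * |Cr| := div_mul_cancel₀ _ hη.ne'
      have h4 : 8 * |A₀| * |Cr| / η ≤ Γ := by linarith
      have h5 : 8 * |A₀| * |Cr| ≤ η * Γ := by
        calc 8 * |A₀| * |Cr| = 8 * |A₀| * |Cr| / η * η := e.symm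
          _ ≤ Γ * η := mul_le_mul_of_nonneg_right h4 hη.le
          _ = η * Γ := mul_comm _ _
      linarith
    calc 2 * |A₀| * |Cr| * Γ⁻¹ ≤ η / 2 := h1
      _ = η * 1 / 2 := by ring
      _ ≤ η * √Γ / 2 := by gcongr
  obtain ⟨C₀, M, U, P, hconcl⟩ := concl1A_of_base_gate hbase hgate h16 hhalf hηΓ
  exact ⟨α₁, C₀, M, U, P, hconcl⟩

/-- Corollary: the re-cut dressing together with the ORIGINAL gate stub S2′ `EventualSharpGate1A` (gate around every dressed base of every A1α
skeleton) also gives the live crux. [folklore] -/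
theorem TransverseReduction1AG_of_sharp1AG' (h1 : DressedBase1AG) (h2 : EventualSharpGate1A) : TransverseReduction1AG :=
  TransverseReduction1AG_of_sharp1AG h1 (eventualSharpGate1AG_of_1A h2)

end Summit.NavierStokesRegularity.NavierStokesRegularity.Theorems.KelvinGate

end
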